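import Summits.Schanuel.Schanuel.Theorems.RootDecomp1EUnsaturatedCore02

/-!
# RootDecomp1E · round 13 (lens-2 «structural dichotomy», gen 13) — UNSATURATED CORE, part 3 of 4

Continuation of `RootDecomp1EUnsaturatedCore02`.  This part: §5 continued: the ladder CEILING at M₁ (barrier B3, two among FOUR under smallTrdeg_thm_2_9_two_two) and §6 THEOREM B, first half: the log-plane family (1, ℓ₁, ℓ₂) — linear independence, multipliers, plain-class membership, `plainDemand_logPlaneTriple_iff`.  Source: lens-2 g13 `UnsaturatedCore.lean`
(sha256 0f7762d0…) lines 606–812 verbatim (namespace renamed `…Theses.UnsaturatedCore` →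
`…Theorems.RootDecomp1EUnsaturatedCore` for the Theorems tree); port `--supports stmt-Schanuel-25020`
(critic g6 cleared LOW).  Sorry-free; standard axioms; nothing here proves Schanuel (rung 0).
-/

noncomputable section

namespace Summit.Schanuel.Schanuel.Theorems.RootDecomp1EUnsaturatedCore

open Complex IntermediateField
open Summit.Schanuel.Schanuel.Theses.RootDecomp1E (DefectOneSchanuel SaturatedSchanuel PlainDefectOne
  ClosedFormAtomSchanuel AlgAnchoredDarkAtomSchanuel LineLogDarkAtomSchanuel DeepLogDarkAtomSchanuel
  OffAxisClosure FreeDarkAtomSchanuel)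
open Summit.Schanuel.Schanuel.Theorems.RootDecomp1EAnchor (isAlgebraic_of_mem_adjoin trdeg_adjoin_le_of_isAlgebraic
  trdeg_le_of_mem_span trdeg_eq_of_span_eq isAlgebraic_of_trdeg_sandwich gens_cons_isAlgebraic Saturated)
open Summit.Schanuel.Schanuel.Theorems.RootDecomp1EEngineType (trdeg_eq_nat two_le_trdeg_of_algebraicIndependent
  algebraicIndependent_pi_exp_pi)
open Summit.Schanuel.Schanuel.Theorems.RootDecomp1EModuleGrids (subMinimal_three rat_mul_pi_eq_rat
  rat_log_two_log_three_indep)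
open Summit.Schanuel.Schanuel.Theorems.RootDecomp1EModuleType (SubMinimalDefect)
open Summit.Schanuel.Schanuel.Theorems.RootDecomp1ELevels (le_trdeg_of_algebraicIndependent)
open Literature.NumberTheory.Transcendental (transcendental_exp_holds nesterenko exists_nsmul_mem_span_int
  ExpOneAddPiIrrational ExpOnePiAlgebraicIndependent)
open Literature.Barriers.Schanuel (AlgIndepLogarithms algIndepLogarithms_of_schanuel linearIndependent_piI_log_two
  algebraicIndependent_piI_log_two_of_algIndepLogarithms gridField₂ smallTrdeg_thm_2_9_two_two)

/-! ### The ladder CEILING at `M₁` (barrier B3, Gel'fond–Brownawell–Waldschmidt grids): two among FOUR -/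

/-- `(1, 1/log 2)` is ℚ-free (`log 2 ∉ ℚ`). -/
theorem linearIndependent_one_inv_log_two :
    LinearIndependent ℚ ![(1 : ℂ), (((Real.log 2)⁻¹ : ℝ) : ℂ)] := by
  rw [LinearIndependent.pair_iff]
  intro s t hst
  rw [Rat.smul_def, Rat.smul_def, mul_one] at hst
  have hre := congrArg Complex.re hst
  simp only [Complex.add_re, Complex.mul_re, Complex.ratCast_re, Complex.ratCast_im, Complex.ofReal_re,
    Complex.ofReal_im, mul_zero, sub_zero, Complex.zero_re] at hre
  have hlog : Real.log 2 ≠ 0 := (Real.log_pos one_lt_two).ne'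
  have h' : (s : ℝ) * Real.log 2 + t = 0 := by
    have := congrArg (· * Real.log 2) hre
    simpa [add_mul, inv_mul_cancel_right₀ hlog, mul_assoc] using this
  by_cases hs : s = 0
  · subst hs
    have ht : (t : ℝ) = 0 := by simpa using h'
    exact ⟨rfl, by exact_mod_cast ht⟩
  · exfalso
    have hs' : (s : ℝ) ≠ 0 := by exact_mod_cast hs
    refine irrational_log_two ⟨-t / s, ?_⟩
    push_cast
    rw [div_eq_iff hs']
    linear_combination -h'

/-- piece:ceiling(a″) · **THE STRONGEST KNOWN STATEMENT TOWARD `M₁`'s DEMAND**: at least two of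
`e, iπ, log 2, κ` with the closing exponential `κ = e^{iπ/log 2}` are algebraically independent — the
Brownawell–Waldschmidt `2 × 2` grid `x = (1, 1/log 2)`, `y = (iπ, log 2)` (`e^{x₁y} = (-1, 2) ⊂ ℚ̄`,
`e^{x₂y} = (κ, e)`; the named fact `smallTrdeg_thm_2_9_two_two` is PROVED in the tree,
`LargeTranscendenceDegreeTwoTwoProofs.smallTrdeg_thm_2_9_two_two_holds`, taken in hypothesis form here only because
that proof cone is not built on the check farm). The member's demand is this statement with `κ` REMOVED: exactly
the step the grid method (barrier B3) cannot take. -/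
theorem two_le_trdeg_e_piI_log_two_kappa (hBW : smallTrdeg_thm_2_9_two_two) :
    (2 : Cardinal) ≤ Algebra.trdeg ℚ ↥(adjoin ℚ ({cexp 1, (Real.pi : ℂ) * I, (Real.log 2 : ℂ),
      cexp ((Real.pi : ℂ) * I / (Real.log 2 : ℂ))} : Set ℂ)) := by
  have hlog : (Real.log 2 : ℂ) ≠ 0 := by exact_mod_cast (Real.log_pos one_lt_two).ne'
  have hexp2 : cexp (Real.log 2 : ℂ) = 2 := by
    rw [← Complex.ofReal_exp, Real.exp_log two_pos]
    norm_num
  have hinv : (((Real.log 2)⁻¹ : ℝ) : ℂ) = (Real.log 2 : ℂ)⁻¹ := by push_cast; rfl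
  set K : IntermediateField ℚ ℂ := adjoin ℚ ({cexp 1, (Real.pi : ℂ) * I, (Real.log 2 : ℂ),
      cexp ((Real.pi : ℂ) * I / (Real.log 2 : ℂ))} : Set ℂ) with hK
  have he : cexp 1 ∈ K := subset_adjoin ℚ _ (by simp)
  have hpi : (Real.pi : ℂ) * I ∈ K := subset_adjoin ℚ _ (by simp)
  have hl2 : (Real.log 2 : ℂ) ∈ K := subset_adjoin ℚ _ (by simp)
  have hκ : cexp ((Real.pi : ℂ) * I / (Real.log 2 : ℂ)) ∈ K := subset_adjoin ℚ _ (by simp)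
  let x : Fin 2 → ℂ := ![(1 : ℂ), (((Real.log 2)⁻¹ : ℝ) : ℂ)]
  let y : Fin 2 → ℂ := ![(Real.pi : ℂ) * I, (Real.log 2 : ℂ)]
  have h00 : cexp (x 0 * y 0) = -1 := by simp [x, y, Complex.exp_pi_mul_I]
  have h01 : cexp (x 0 * y 1) = 2 := by simpa [x, y] using hexp2
  have h10 : cexp (x 1 * y 0) = cexp ((Real.pi : ℂ) * I / (Real.log 2 : ℂ)) := by
    simp only [x, y, Matrix.cons_val_one, Matrix.cons_val_zero, Matrix.cons_val_fin_one, hinv]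
    congr 1
    field_simp
  have h11 : cexp (x 1 * y 1) = cexp 1 := by
    simp only [x, y, Matrix.cons_val_one, Matrix.cons_val_fin_one, hinv]
    rw [inv_mul_cancel₀ hlog]
  have h2 := hBW x y linearIndependent_one_inv_log_two linearIndependent_piI_log_two
    (by rw [h00]; exact_mod_cast isAlgebraic_int (R := ℚ) (A := ℂ) (-1))
    (by rw [h01]; exact_mod_cast isAlgebraic_nat (R := ℚ) (A := ℂ) 2)
  refine h2.trans (trdeg_adjoin_le_of_isAlgebraic ?_)
  rintro v ((⟨i, rfl⟩ | ⟨i, rfl⟩) | ⟨⟨i, j⟩, rfl⟩)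
  · fin_cases i
    · exact isAlgebraic_of_mem_adjoin (by simp [x])
    · exact isAlgebraic_of_mem_adjoin (by simpa [x, hinv] using inv_mem hl2)
  · fin_cases i
    · exact isAlgebraic_of_mem_adjoin (by simpa [y] using hpi)
    · exact isAlgebraic_of_mem_adjoin (by simpa [y] using hl2)
  · fin_cases i <;> fin_cases j
    · exact isAlgebraic_of_mem_adjoin (by simp [h00])
    · exact isAlgebraic_of_mem_adjoin (by simp [h01])
    · exact isAlgebraic_of_mem_adjoin (by simpa [h10] using hκ)
    · exact isAlgebraic_of_mem_adjoin (by simpa [h11] using he)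

/-- `S⁻` (stmt-25020) itself, of course, also delivers the demand at `M₁` (it is a genuine `S⁻₃` instance). -/
theorem logTwoTriple_demand_of_defectOne (hD : DefectOneSchanuel) :
    ((3 : ℕ) : Cardinal) ≤
      Algebra.trdeg ℚ ↥(adjoin ℚ (Set.range logTwoTriple ∪ Set.range (cexp ∘ logTwoTriple))) + 1 :=
  hD 3 logTwoTriple logTwoTriple_linearIndependent

/-! ## §6 THEOREM B: the LOG-PLANE FAMILY `(1, ℓ₁, ℓ₂)` — PLAIN 31410 on it is the named statement `ELogPlane`

For EVERY ℚ-linearly independent pair `ℓ₁, ℓ₂` of logarithms of algebraic numbers (`e^{ℓ₁}, e^{ℓ₂} ∈ ℚ̄`) the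
triple `(1, ℓ₁, ℓ₂)` is a member of 31410's hypothesis class BY THEOREM (Hermite–Lindemann does all the work:
an algebraic number inside `span_ℚ(ℓ₁, ℓ₂)` is `0`), and 31410's demand there decodes to
`trdeg_ℚ ℚ(e, ℓ₁, ℓ₂) ≥ 2`. So `PlainDefectOne` restricted to this family IS the statement

  `ELogPlane :  ∀ ℚ-LI ℓ₁, ℓ₂ ∈ 𝓛,  trdeg_ℚ ℚ(e, ℓ₁, ℓ₂) ≥ 2`  («two of `e, ℓ₁, ℓ₂` are algebraically independent»),

which the two-variable case of `AlgIndepLogarithms` implies (`eLogPlane_of_algIndepLogarithms`) — a conditional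
reduction to a printed conjecture on the `𝓛`-side, strictly below Schanuel. `M₁ = (1, iπ, log 2)` (§5) and
`M₂ = (1, log 2, log 3)` are its first instances. -/

/-- Hermite–Lindemann as a vanishing principle: an algebraic number with algebraic exponential is `0`
(tree theorem `transcendental_exp_holds`). -/
private theorem eq_zero_of_isAlgebraic_of_isAlgebraic_exp {x : ℂ} (hx : IsAlgebraic ℚ x)
    (hex : IsAlgebraic ℚ (cexp x)) : x = 0 := by
  by_contra h
  exact transcendental_exp_holds hx h hex

/-- `e^{k₀ℓ₁ + k₁ℓ₂} = (e^{ℓ₁})^{k₀} (e^{ℓ₂})^{k₁}` is algebraic for `k₀, k₁ ∈ ℤ` when `e^{ℓ₁}, e^{ℓ₂}` are. -/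
theorem isAlgebraic_exp_int_comb {ℓ₁ ℓ₂ : ℂ} (h₁ : IsAlgebraic ℚ (cexp ℓ₁)) (h₂ : IsAlgebraic ℚ (cexp ℓ₂))
    (k₀ k₁ : ℤ) : IsAlgebraic ℚ (cexp (k₀ * ℓ₁ + k₁ * ℓ₂)) := by
  rw [Complex.exp_add, Complex.exp_int_mul, Complex.exp_int_mul]
  exact mem_algebraicClosure_iff.1 (mul_mem (zpow_mem (mem_algebraicClosure_iff.2 h₁) k₀)
    (zpow_mem (mem_algebraicClosure_iff.2 h₂) k₁))

/-- piece:proved · **KEY (H–L on a log plane).** If `e^{ℓ₁}, e^{ℓ₂} ∈ ℚ̄`, the only algebraic number in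
`span_ℚ(ℓ₁, ℓ₂)` is `0` (clear denominators, exponentiate, Hermite–Lindemann). -/
theorem eq_zero_of_mem_span_logs {ℓ₁ ℓ₂ x : ℂ} (h₁ : IsAlgebraic ℚ (cexp ℓ₁)) (h₂ : IsAlgebraic ℚ (cexp ℓ₂))
    (hx : x ∈ Submodule.span ℚ (Set.range ![ℓ₁, ℓ₂])) (halg : IsAlgebraic ℚ x) : x = 0 := by
  obtain ⟨N, hN, hmem⟩ := exists_nsmul_mem_span_int ![ℓ₁, ℓ₂] hx
  obtain ⟨k, hk⟩ := (Submodule.mem_span_range_iff_exists_fun ℤ).mp hmem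
  have hNx : (N : ℚ) • x = (k 0 : ℂ) * ℓ₁ + (k 1 : ℂ) * ℓ₂ := by
    rw [← hk]
    simp [Fin.sum_univ_two, zsmul_eq_mul]
  have halgN : IsAlgebraic ℚ ((N : ℚ) • x) := by
    rw [Rat.smul_def]
    exact mem_algebraicClosure_iff.1 (mul_mem (by simp) (mem_algebraicClosure_iff.2 halg))
  have hzero : (N : ℚ) • x = 0 := by
    rw [hNx] at halgN ⊢
    exact eq_zero_of_isAlgebraic_of_isAlgebraic_exp halgN (isAlgebraic_exp_int_comb h₁ h₂ (k 0) (k 1))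
  rw [Rat.smul_def] at hzero
  rcases mul_eq_zero.mp hzero with h | h
  · exfalso
    exact hN (by exact_mod_cast h)
  · exact h

/-- piece:member(b″) · `(1, ℓ₁, ℓ₂)` is ℚ-free (`1` is algebraic and nonzero, so `1 ∉ span_ℚ(ℓ₁, ℓ₂)`). -/
theorem logPlaneTriple_linearIndependent {ℓ₁ ℓ₂ : ℂ} (hLI : LinearIndependent ℚ ![ℓ₁, ℓ₂])
    (h₁ : IsAlgebraic ℚ (cexp ℓ₁)) (h₂ : IsAlgebraic ℚ (cexp ℓ₂)) :
    LinearIndependent ℚ ![(1 : ℂ), ℓ₁, ℓ₂] := by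
  refine (linearIndependent_finCons (x := (1 : ℂ)) (v := ![ℓ₁, ℓ₂])).2 ⟨hLI, ?_⟩
  intro hmem
  exact one_ne_zero (eq_zero_of_mem_span_logs h₁ h₂ hmem isAlgebraic_one)

/-- piece:member(b″) · `(1, ℓ₁, ℓ₂)` is PLAIN: an algebraic multiplier `β` has `β = β·1 ∈ span_ℚ(1, ℓ₁, ℓ₂)`, so
`β - a ∈ span_ℚ(ℓ₁, ℓ₂) ∩ ℚ̄ = 0` for some `a ∈ ℚ`. -/
theorem logPlaneTriple_multiplier_rational {ℓ₁ ℓ₂ : ℂ} (h₁ : IsAlgebraic ℚ (cexp ℓ₁))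
    (h₂ : IsAlgebraic ℚ (cexp ℓ₂)) (β : ℂ) (hβalg : IsAlgebraic ℚ β)
    (hβ : ∀ i, β * (![(1 : ℂ), ℓ₁, ℓ₂]) i ∈ Submodule.span ℚ (Set.range ![(1 : ℂ), ℓ₁, ℓ₂])) :
    β ∈ Set.range (algebraMap ℚ ℂ) := by
  obtain ⟨a, ha⟩ := (Submodule.mem_span_range_iff_exists_fun ℚ).mp (hβ 0)
  simp only [Fin.sum_univ_three, Matrix.cons_val_zero, Matrix.cons_val_one, Matrix.cons_val_two,
    Matrix.tail_cons, Matrix.head_cons, mul_one, Rat.smul_def] at ha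
  have hmem : β - (a 0 : ℂ) ∈ Submodule.span ℚ (Set.range ![ℓ₁, ℓ₂]) := by
    have : β - (a 0 : ℂ) = a 1 • ℓ₁ + a 2 • ℓ₂ := by
      simp only [Rat.smul_def]
      linear_combination -ha
    rw [this]
    exact Submodule.add_mem _ (Submodule.smul_mem _ _ (Submodule.subset_span ⟨0, by simp⟩))
      (Submodule.smul_mem _ _ (Submodule.subset_span ⟨1, by simp⟩))
  have halg : IsAlgebraic ℚ (β - (a 0 : ℂ)) :=
    mem_algebraicClosure_iff.1 (sub_mem (mem_algebraicClosure_iff.2 hβalg) (by simp))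
  have h0 := eq_zero_of_mem_span_logs h₁ h₂ hmem halg
  rw [sub_eq_zero] at h0
  exact ⟨a 0, by simp [h0]⟩

/-- piece:member(b″) · **THE LOG-PLANE FAMILY lies in 31410's hypothesis class, BY THEOREM** (ℚ-free, plain,
sub-minimal), for every ℚ-LI pair of logarithms of algebraic numbers. -/
theorem logPlaneTriple_mem_plainClass {ℓ₁ ℓ₂ : ℂ} (hLI : LinearIndependent ℚ ![ℓ₁, ℓ₂])
    (h₁ : IsAlgebraic ℚ (cexp ℓ₁)) (h₂ : IsAlgebraic ℚ (cexp ℓ₂)) :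
    LinearIndependent ℚ ![(1 : ℂ), ℓ₁, ℓ₂] ∧
      (∀ β : ℂ, IsAlgebraic ℚ β →
        (∀ i, β * (![(1 : ℂ), ℓ₁, ℓ₂]) i ∈ Submodule.span ℚ (Set.range ![(1 : ℂ), ℓ₁, ℓ₂])) →
          β ∈ Set.range (algebraMap ℚ ℂ)) ∧ SubMinimalDefect 3 ![(1 : ℂ), ℓ₁, ℓ₂] :=
  ⟨logPlaneTriple_linearIndependent hLI h₁ h₂, logPlaneTriple_multiplier_rational h₁ h₂, subMinimal_three _⟩

/-- The exponential field of `(1, ℓ₁, ℓ₂)` has the transcendence degree of `ℚ(e, ℓ₁, ℓ₂)` (`e^{ℓᵢ} ∈ ℚ̄`). -/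
theorem trdeg_logPlaneTriple_eq {ℓ₁ ℓ₂ : ℂ} (h₁ : IsAlgebraic ℚ (cexp ℓ₁)) (h₂ : IsAlgebraic ℚ (cexp ℓ₂)) :
    Algebra.trdeg ℚ ↥(adjoin ℚ (Set.range (![(1 : ℂ), ℓ₁, ℓ₂]) ∪ Set.range (cexp ∘ ![(1 : ℂ), ℓ₁, ℓ₂]))) =
      Algebra.trdeg ℚ ↥(adjoin ℚ ({cexp 1, ℓ₁, ℓ₂} : Set ℂ)) := by
  refine le_antisymm (trdeg_adjoin_le_of_isAlgebraic ?_) (trdeg_adjoin_le_of_isAlgebraic ?_)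
  · rintro x (⟨i, rfl⟩ | ⟨i, rfl⟩)
    · fin_cases i
      · exact isAlgebraic_of_mem_adjoin (by simp)
      · exact isAlgebraic_of_mem_adjoin (by simpa using (subset_adjoin ℚ ({cexp 1, ℓ₁, ℓ₂} : Set ℂ) (by simp) : ℓ₁ ∈ _))
      · exact isAlgebraic_of_mem_adjoin (by simpa using (subset_adjoin ℚ ({cexp 1, ℓ₁, ℓ₂} : Set ℂ) (by simp) : ℓ₂ ∈ _))
    · fin_cases i
      · exact isAlgebraic_of_mem_adjoin
          (by simpa using (subset_adjoin ℚ ({cexp 1, ℓ₁, ℓ₂} : Set ℂ) (by simp) : cexp 1 ∈ _))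
      · simpa using h₁.tower_top (adjoin ℚ ({cexp 1, ℓ₁, ℓ₂} : Set ℂ))
      · simpa using h₂.tower_top (adjoin ℚ ({cexp 1, ℓ₁, ℓ₂} : Set ℂ))
  · intro x hx
    simp only [Set.mem_insert_iff, Set.mem_singleton_iff] at hx
    rcases hx with rfl | rfl | rfl
    · exact isAlgebraic_of_mem_adjoin (subset_adjoin ℚ _ (Or.inr ⟨0, by simp⟩))
    · exact isAlgebraic_of_mem_adjoin (subset_adjoin ℚ _ (Or.inl ⟨1, by simp⟩))
    · exact isAlgebraic_of_mem_adjoin (subset_adjoin ℚ _ (Or.inl ⟨2, by simp⟩))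

/-- piece:member(b″) · 31410's demand at `(1, ℓ₁, ℓ₂)`, DECODED: `trdeg_ℚ ℚ(e, ℓ₁, ℓ₂) ≥ 2`. -/
theorem plainDemand_logPlaneTriple_iff {ℓ₁ ℓ₂ : ℂ} (h₁ : IsAlgebraic ℚ (cexp ℓ₁))
    (h₂ : IsAlgebraic ℚ (cexp ℓ₂)) :
    (((3 : ℕ) : Cardinal) ≤ Algebra.trdeg ℚ ↥(adjoin ℚ (Set.range (![(1 : ℂ), ℓ₁, ℓ₂]) ∪
        Set.range (cexp ∘ ![(1 : ℂ), ℓ₁, ℓ₂]))) + 1) ↔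
      ((2 : Cardinal) ≤ Algebra.trdeg ℚ ↥(adjoin ℚ ({cexp 1, ℓ₁, ℓ₂} : Set ℂ))) := by
  obtain ⟨t, ht, -⟩ := trdeg_eq_nat ![(1 : ℂ), ℓ₁, ℓ₂]
  rw [← trdeg_logPlaneTriple_eq h₁ h₂, ht]
  constructor
  · intro h
    have : 3 ≤ t + 1 := by exact_mod_cast h
    exact_mod_cast (show 2 ≤ t by omega)
  · intro h
    have : 2 ≤ t := by exact_mod_cast h
    exact_mod_cast (show 3 ≤ t + 1 by omega)

end Summit.Schanuel.Schanuel.Theorems.RootDecomp1EUnsaturatedCore
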